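import Mathlib.GroupTheory.SpecificGroups.Cyclic
import Mathlib.SetTheory.Cardinal.Finite
import Literature.Topology.FourManifolds.Cobordism
import Literature.Topology.FourManifolds.HomotopySpheres
import Literature.Topology.FourManifolds.Spin
import Literature.Topology.FourManifolds.CerfGammaFourProofs
import HarnessLib

/-!
# Homotopy spheres bounding parallelizable manifolds: the subgroup `bPₙ₊₁ ⊆ Θₙ`

Trunk T-4MAN (`FourManifolds`). Kervaire–Milnor, *Groups of homotopy spheres I*, Ann. of Math.
77 (1963), §4 and §7: the subset `bPₙ₊₁ ⊆ Θₙ` of classes of homotopy `n`-spheres which bound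
parallelizable manifolds, and the two theorems through which `Θ₇` is computed,

* `Θ₇ = bP₈` (§4: `Θₙ / bPₙ₊₁` embeds into `Πₙ / p(Sⁿ) = coker Jₙ` by the Pontryagin–Thom
  construction, Lemmas 4.2–4.5, and `Π₇ / p(S⁷) = 0`, table p. 512), vendored as the named fact
  `Literature.Topology.FourManifolds.HomotopySphere.boundsParallelizable_seven`;
* `bP₄ₘ`, `m > 1`, is a finite cyclic group (Cor. 7.6, from Thm. 7.5: a homotopy `(4m-1)`-sphere
  bounding an s-parallelizable `M` is determined by the signature `σ(M) mod σₘ`), vendored as the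
  named fact `Literature.Topology.FourManifolds.HomotopySphereClass.isCyclic_bP_four_mul`.

Together with the group structure on `Θₙ` (`Literature.Topology.FourManifolds.exists_commGroup_homotopySphereClass`,
Kervaire–Milnor Thm. 1.1) they yield that `Θ₇` is cyclic (of order `28` by Part II / Milnor–Kervaire
1958; the order is the separate fact `Literature.Topology.FourManifolds.natCard_homotopySphereClass_seven`); the assembly is
the sorry-free theorem `Literature.Topology.FourManifolds.exists_commGroup_homotopySphereClass_isCyclic_seven_of` of
`HCobordismProofs.lean`. This file is the first layer of the decomposition of the named fact
`Literature.Topology.FourManifolds.exists_commGroup_homotopySphereClass_isCyclic_seven` (`HCobordism.lean`); the deeper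
layers (Pontryagin–Thom construction and `p(M)`, `Π₇ ≅ ℤ/240` and the surjectivity of `J₇`,
surgery below the middle dimension, the signature obstruction and Thm. 7.5) are recorded in its
docstrings as the sources of the two facts and are not formalised here (they are taken up
downstream, in the sibling files `HomotopySpheresStablyParallelizable*.lean`,
`PontryaginThomCollapse*.lean`, `HomotopySpheresSignature*.lean`, `HomotopySpheresBPCyclic*.lean`
and `HomotopySpheresBPProofs.lean`).

## Main definitions

* `Literature.NullCobordism n M`: a compact smooth `(n+1)`-manifold with boundary `W` (model
  `𝓡∂ (n + 1)`) together with a smooth embedding `M ↪ W` onto `∂W` ("`M = ∂W`"), in the style of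
  `Literature.Topology.FourManifolds.Cobordism` (a null-cobordism is a cobordism to the empty manifold).
* `Literature.BoundsParallelizable n M`: `M` bounds a *parallelizable* compact manifold
  (`Literature.Topology.FourManifolds.IsParallelizable`, `Spin.lean`: the tangent bundle admits a global continuous framing).
* `Literature.HomotopySphere.BoundsParallelizable S`, `Literature.HomotopySphereClass.bP n : Set (Θₙ)`:
  Kervaire–Milnor's `bPₙ₊₁` as a subset of `Θₙ = HomotopySphereClass n`.

## Main statements

* `NullCobordism.closedBall n : NullCobordism n 𝕊ⁿ` (real definition): `𝕊ⁿ = ∂𝔻ⁿ⁺¹`, from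
  the closed-ball manifold of `ClosedBall.lean`.
* `NullCobordism.toCobordism`, `NullCobordism.ofCobordism` (real definitions): a
  null-cobordism of `M` is the same as an `Literature.Cobordism n M N` to an empty `N` (Milnor 1965,
  §1, Def. 1.3, the triad `(W; M, ∅)`), bridging to `Cobordism.lean`/`Bordism.lean`.
* `NullCobordism.comap`, `BoundsParallelizable.of_diffeomorph`,
  `HomotopySphereClass.mk_mem_bP_iff`, `HomotopySphereClass.neg_mem_bP_iff` (proved): bounding a
  parallelizable manifold is invariant under diffeomorphism and orientation reversal, so `bP` is
  well defined on `Θₙ` (Kervaire–Milnor 1963, §4, first paragraph, and Lemma 4.3 for the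
  h-cobordism quotient).
* `HomotopySphere.boundsParallelizable_seven` (named fact): every homotopy `7`-sphere bounds a
  parallelizable manifold, i.e. `bP₈ = Θ₇` (`HomotopySphereClass.bP_seven_eq_univ`, proved from it).
* `HomotopySphere.isStablyParallelizable` (named fact, Kervaire–Milnor Thm. 3.1): every
  homotopy sphere is s-parallelizable; `HomotopySphere.boundsParallelizable_of_isStablyParallelizable_seven`
  (named fact, §4 for `n = 7`: Lemmas 4.2, 4.5 and `Π₇ / p(S⁷) = 0`): an s-parallelizable homotopy
  `7`-sphere bounds a parallelizable manifold; `HomotopySphere.boundsParallelizable_seven_of`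
  (proved): together they give `boundsParallelizable_seven` — the second layer of the
  decomposition, separating the two deep inputs (Bott periodicity / obstruction theory, and the
  Pontryagin–Thom construction with `coker J₇ = 0`). Thm. 3.1 enters here only at `n = 7`, and
  that instance is now *proved* downstream (`HomotopySphere.isStablyParallelizable_seven_of`,
  `HomotopySpheresStablyParallelizable.lean`, from Bott's `π₆(SO(8)) = 0` and the triviality of
  the stable tangent bundle off a point), the parent being rewired there
  (`HomotopySphere.boundsParallelizable_seven_of'`); the all-`n` fact is thus no longer a leaf of
  the `Θ₇` decomposition and is retained, unchanged, as the printed statement, consumed at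
  `n = 4` by the `Θ₄ = 0` chain (`ThetaFourKervaireMilnor.lean`) — see its docstring.
* `HomotopySphereClass.isCyclic_bP_four_mul` (named fact): for `n + 1 = 4m`, `m > 1`, and any
  commutative group structure on `Θₙ` whose multiplication is the connected sum, `bPₙ₊₁ = bP₄ₘ`
  is (the underlying set of) a finite cyclic subgroup (Kervaire–Milnor 1963, Cor. 7.6).

## Design choices

* **Orientations.** Kervaire–Milnor's manifolds are oriented and "`M = bW`" is an equality of
  oriented manifolds. `BoundsParallelizable` ignores orientations: a parallelizable `W` is
  orientable, `∂(-W) = -∂W`, and a homotopy sphere of dimension `≥ 1` is connected, so `Σ` bounds a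
  parallelizable manifold in the unoriented sense iff `(Σ, o)` does in the oriented sense, for
  either orientation `o` (this is also why `bP` is stable under `neg`, `neg_mem_bP_iff`).
* **Which quotient.** Kervaire–Milnor's `Θₙ` is the h-cobordism quotient and `bPₙ₊₁` is
  h-cobordism invariant by Lemma 4.3 (Pontryagin–Thom). The tree's `Θₙ = HomotopySphereClass n` is
  the quotient by orientation-preserving diffeomorphism (equal to Kervaire–Milnor's for `n ≥ 5` by
  Smale, `HomotopySphere.isHCobordant_iff_nonempty_diffeomorph_of_five_le`), on which invariance
  is elementary (`mk_mem_bP_iff`); `bP n` is *defined* as the image of the bounding homotopy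
  spheres, so no choice of representatives is involved.
* **No group structure is fixed on `Θₙ`.** The tree provides the group structure only as the
  named fact `Literature.Topology.FourManifolds.exists_commGroup_homotopySphereClass` (any structure whose multiplication is
  the relational connected sum `HomotopySphereClass.IsMul`; it is unique by
  `HomotopySphereClass.isMul_exists`/`isMul_unique`). Accordingly `isCyclic_bP_four_mul`
  quantifies over all such structures, and states Cor. 7.6 as "`bP₄ₘ` is the carrier of a finite
  cyclic subgroup".
  This file states only the printed consequence "Hence `bP₄ₘ` is finite cyclic" of Cor. 7.6.
  Its primary clause (`bP₄ₘ ↪ ℤ/σₘ`, `σₘ` the minimal positive signature of an s-parallelizable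
  `4m`-manifold bounded by `S⁴ᵐ⁻¹`) needs the signature of manifolds with boundary and is
  vendored downstream, in `HomotopySpheresSignature.lean` (`HomotopySphere.signatureSet`,
  `HomotopySphere.sigmaGen`, and the printed ingredients of the "evident" proof as named facts:
  Lemma 7.4, Thm. 7.5, §2-additivity of `σ`, the two Lemma 3.4 comparisons), from which
  `HomotopySpheresBPCyclic.lean` **proves** this fact
  (`HomotopySphereClass.isCyclic_bP_four_mul_of_signatureFacts`); see the docstring of
  `isCyclic_bP_four_mul` for the resulting proof obligation.
* `NullCobordism` records the boundary identification as an embedding `M ↪ W` onto `∂W` exactly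
  as `Literature.Topology.FourManifolds.Cobordism` records its two ends and `Literature.Topology.FourManifolds.BoundaryData` records `∂W`
  (`NullCobordism.boundaryData`); it is interchangeable with a `Cobordism n M N` to an empty `N`
  (`toCobordism`/`ofCobordism`), and is introduced as a separate one-ended structure only to
  avoid carrying an empty second end (and its `ChartedSpace` instance) through every statement.
  Transport along a diffeomorphism of `M` uses
  `Manifold.IsSmoothEmbedding.comp_diffeomorph`, which the tree keeps in
  `CerfGammaFourProofs.lean` — imported for that lemma (and, through it, `ClosedBall.lean` for
  `NullCobordism.closedBall`).
* Not in this file: "`𝔻ⁿ⁺¹` is parallelizable" (so `[𝕊ⁿ] ∈ bPₙ₊₁`, Kervaire–Milnor §4 (1)) — the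
  global framing of Mathlib's `TangentBundle (𝓡∂ (n + 1)) 𝔻ⁿ⁺¹`, continuous across the boundary
  charts, is proved downstream as `Literature.Topology.FourManifolds.IsParallelizable.closedBall`
  (`ClosedBallParallelizable.lean`), whence `Literature.Topology.FourManifolds.boundsParallelizable_sphere :
  BoundsParallelizable n 𝕊ⁿ` (`HomotopySpheresBPOrder.lean`); neither is needed for `Θ₇`.

## References

* M. Kervaire, J. Milnor, *Groups of homotopy spheres I*, Ann. of Math. 77 (1963), 504–537:
  §4 (definition of `bPₙ₊₁`, Lemmas 4.2–4.5, Thm. 4.1, table p. 512), §7 (Thm. 7.5, Cor. 7.6,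
  p. 530). [KervaireMilnorAnnals1963]
* A. Kosinski, *Differential Manifolds* (1993), Ch. X §6: Prop. 6.2(a) (`bP⁴ⁿ` finite cyclic of
  order `tₙ/8`), exact sequence (6.6) `0 → bPᵐ⁺¹ → θᵐ → Coker Jₘ`, and "since `Coker J₇ = 0`,
  `θ⁷ = ℤ₂₈`" (p. 218). [Kosinski1993]
* J. Milnor, *Lectures on the h-cobordism theorem* (1965), §1 (Def. 1.3: smooth manifold
  triads `(W; V₀, V₁)`; Def. 1.5: cobordisms) and Thm. 9.1. [MilnorHCobordism1965]
-/

open scoped Manifold ContDiff Topology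
open Set Function

noncomputable section

namespace Literature.Topology.FourManifolds

universe u

/-- Local notation: `𝔼 n` is the model Euclidean space `EuclideanSpace ℝ (Fin n)`. -/
local notation "𝔼 " n:arg => EuclideanSpace ℝ (Fin n)

/-- Local notation: `𝕊 n` is the unit sphere in `EuclideanSpace ℝ (Fin (n + 1))`. -/
local notation "𝕊 " n:arg => (Metric.sphere (0 : EuclideanSpace ℝ (Fin (n + 1))) 1)

/-- Local notation: `𝔻 n` is the closed unit ball in `EuclideanSpace ℝ (Fin n)` (a compact smooth
manifold with boundary, `Literature.Topology.FourManifolds.instChartedSpaceClosedBall`, `ClosedBall.lean`). -/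
local notation "𝔻 " n:arg => (Metric.closedBall (0 : EuclideanSpace ℝ (Fin n)) 1)

/-! ### Null-cobordisms and bounding a parallelizable manifold -/

/-- A (smooth, unoriented) **null-cobordism** of an `n`-dimensional charted space `M`: a compact
Hausdorff second-countable smooth `(n+1)`-manifold with boundary `W` (model `𝓡∂ (n + 1)`) and a
smooth embedding `incl : M → W` whose range is exactly the boundary `∂W` — "`M` is the boundary
of `W`". This is an `Literature.Cobordism n M ∅` with the empty end removed (Milnor, *Lectures on the
h-cobordism theorem* (1965), §1; Kervaire–Milnor 1963, §1: "`bM` denotes the boundary of `M`").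
As for `Literature.Topology.FourManifolds.Cobordism`, no smoothness is imposed on `M` (for a non-smooth atlas the type is
empty) and `W : Type u` lives in the universe of `M`. [cite: KervaireMilnorAnnals1963, §1 and §4] -/
structure NullCobordism (n : ℕ) (M : Type u) [TopologicalSpace M] [ChartedSpace (𝔼 n) M] where
  /-- The bounding manifold, an `(n+1)`-manifold with boundary. -/
  W : Type u
  /-- The topology on `W`. -/
  [topologicalSpace : TopologicalSpace W]
  /-- `W` is Hausdorff. -/
  [t2Space : T2Space W]
  /-- `W` is second countable. -/
  [secondCountableTopology : SecondCountableTopology W]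
  /-- The atlas of `W`, modelled on the half-space `EuclideanHalfSpace (n + 1)`. -/
  [chartedSpace : ChartedSpace (EuclideanHalfSpace (n + 1)) W]
  /-- `W` is a smooth manifold with boundary. -/
  [isManifold : IsManifold (𝓡∂ (n + 1)) ∞ W]
  /-- `W` is compact. -/
  [compactSpace : CompactSpace W]
  /-- The inclusion of `M` as the boundary of `W`. -/
  incl : M → W
  /-- `incl` is a smooth embedding. -/
  isSmoothEmbedding_incl : Manifold.IsSmoothEmbedding (𝓡 n) (𝓡∂ (n + 1)) ∞ incl
  /-- The image of `incl` is the whole boundary `∂W`. -/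
  range_incl : range incl = (𝓡∂ (n + 1)).boundary W

attribute [instance] NullCobordism.topologicalSpace NullCobordism.t2Space
  NullCobordism.secondCountableTopology NullCobordism.chartedSpace NullCobordism.isManifold
  NullCobordism.compactSpace

namespace NullCobordism

variable {n : ℕ} {M M' : Type u} [TopologicalSpace M] [ChartedSpace (𝔼 n) M]
  [TopologicalSpace M'] [ChartedSpace (𝔼 n) M']

/-- The boundary inclusion of a null-cobordism is continuous (it is a topological embedding).
[folklore] -/
theorem continuous_incl (c : NullCobordism n M) : Continuous c.incl :=
  c.isSmoothEmbedding_incl.isEmbedding.continuous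

/-- The boundary inclusion of a null-cobordism is injective (it is a topological embedding).
[folklore] -/
theorem injective_incl (c : NullCobordism n M) : Injective c.incl :=
  c.isSmoothEmbedding_incl.isEmbedding.injective

/-- Every point of `M` is mapped to a boundary point of `W`. [folklore] -/
theorem incl_mem_boundary (c : NullCobordism n M) (x : M) : c.incl x ∈ (𝓡∂ (n + 1)).boundary c.W :=
  c.range_incl ▸ mem_range_self x

/-- A null-cobordism `M = ∂W` of a smooth `M` *is* a boundary datum of `W` with carrier `M`
(`Literature.Topology.FourManifolds.BoundaryData`; Lee, *Introduction to Smooth Manifolds* (2013), Thm. 5.11). [folklore] -/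
def boundaryData [IsManifold (𝓡 n) ∞ M] (c : NullCobordism n M) :
    BoundaryData (𝓡∂ (n + 1)) c.W (𝓡 n) where
  carrier := M
  incl := c.incl
  isSmoothEmbedding := c.isSmoothEmbedding_incl
  range_incl := c.range_incl

/-- The carrier of the boundary datum of a null-cobordism of `M` is `M`. [folklore] -/
@[simp] theorem boundaryData_carrier [IsManifold (𝓡 n) ∞ M] (c : NullCobordism n M) :
    c.boundaryData.carrier = M := rfl

/-- The inclusion of the boundary datum of a null-cobordism is its boundary inclusion. [folklore] -/
@[simp] theorem boundaryData_incl [IsManifold (𝓡 n) ∞ M] (c : NullCobordism n M) :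
    c.boundaryData.incl = c.incl := rfl

/-- **Transport of a null-cobordism along a diffeomorphism of the boundary.** If `M = ∂W` and
`φ : M' ≅ M` is a diffeomorphism, then `M' = ∂W` via `incl ∘ φ` (a smooth embedding precomposed
with a diffeomorphism is a smooth embedding, `Manifold.IsSmoothEmbedding.comp_diffeomorph`;
Kervaire–Milnor 1963, §1, "the relation of h-cobordism is implied by diffeomorphism"). [folklore] -/
def comap [IsManifold (𝓡 n) ∞ M] [IsManifold (𝓡 n) ∞ M'] (c : NullCobordism n M)
    (φ : M' ≃ₘ⟮𝓡 n, 𝓡 n⟯ M) : NullCobordism n M' where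
  W := c.W
  incl := c.incl ∘ φ
  isSmoothEmbedding_incl := c.isSmoothEmbedding_incl.comp_diffeomorph φ
  range_incl := by rw [← c.range_incl]; exact (EquivLike.surjective φ).range_comp c.incl

/-- Transport along a diffeomorphism does not change the bounding manifold. [folklore] -/
@[simp] theorem comap_W [IsManifold (𝓡 n) ∞ M] [IsManifold (𝓡 n) ∞ M'] (c : NullCobordism n M)
    (φ : M' ≃ₘ⟮𝓡 n, 𝓡 n⟯ M) : (c.comap φ).W = c.W := rfl

/-- The boundary inclusion of the transported null-cobordism is `incl ∘ φ`. [folklore] -/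
@[simp] theorem comap_incl [IsManifold (𝓡 n) ∞ M] [IsManifold (𝓡 n) ∞ M'] (c : NullCobordism n M)
    (φ : M' ≃ₘ⟮𝓡 n, 𝓡 n⟯ M) : (c.comap φ).incl = c.incl ∘ φ := rfl

/-! #### Null-cobordisms as cobordisms to the empty manifold -/

variable {N : Type u} [TopologicalSpace N] [ChartedSpace (𝔼 n) N]

omit [ChartedSpace (𝔼 n) M] in
/-- A map out of an empty charted space into a manifold with boundary is a smooth embedding:
vacuously an immersion (`Manifold.IsImmersionOfComplement` quantifies over the points of the
domain; complement `ℝ`), and a topological embedding by `Topology.IsEmbedding.of_subsingleton`.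
[folklore] -/
theorem isSmoothEmbedding_of_isEmpty [IsEmpty N] {W : Type*} [TopologicalSpace W]
    [ChartedSpace (EuclideanHalfSpace (n + 1)) W] (f : N → W) :
    Manifold.IsSmoothEmbedding (𝓡 n) (𝓡∂ (n + 1)) ∞ f :=
  ⟨⟨ℝ, inferInstance, inferInstance, fun x => isEmptyElim x⟩, .of_subsingleton f⟩

/-- **A null-cobordism is a cobordism to the empty manifold**: `M = ∂W` gives the cobordism
`(W; M, ∅)` of `Literature.Topology.FourManifolds.Cobordism` (Milnor, *Lectures on the h-cobordism theorem* (1965), §1,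
Def. 1.3, the smooth manifold triad `(W; V₀, V₁)`, here with `V₁ = ∅`; Def. 1.5), for any
empty `N` (e.g. `PEmpty` with `ChartedSpace.empty`, as in `ClosedSingularManifold.empty` of
`Bordism.lean`, so that `BoundsParallelizable` below is a refinement of null-bordism
`IsBordant _ (empty _ _)`).
[cite: MilnorHCobordism1965, §1, Def. 1.3 and Def. 1.5] -/
def toCobordism (c : NullCobordism n M) (N : Type u) [TopologicalSpace N]
    [ChartedSpace (𝔼 n) N] [IsEmpty N] : Cobordism n M N where
  W := c.W
  inl := c.incl
  inr := fun y => isEmptyElim y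
  isSmoothEmbedding_inl := c.isSmoothEmbedding_incl
  isSmoothEmbedding_inr := isSmoothEmbedding_of_isEmpty _
  disjoint_range := by
    rw [Set.range_eq_empty fun y : N => (isEmptyElim y : c.W)]
    exact Set.disjoint_empty _
  range_inl_union_range_inr := by
    rw [Set.range_eq_empty fun y : N => (isEmptyElim y : c.W), Set.union_empty]
    exact c.range_incl

/-- The total space of the cobordism `(W; M, ∅)` of a null-cobordism is `W`. [folklore] -/
@[simp] theorem toCobordism_W (c : NullCobordism n M) (N : Type u) [TopologicalSpace N]
    [ChartedSpace (𝔼 n) N] [IsEmpty N] : (c.toCobordism N).W = c.W := rfl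

/-- The incoming end of the cobordism `(W; M, ∅)` of a null-cobordism is its boundary
inclusion. [folklore] -/
@[simp] theorem toCobordism_inl (c : NullCobordism n M) (N : Type u) [TopologicalSpace N]
    [ChartedSpace (𝔼 n) N] [IsEmpty N] : (c.toCobordism N).inl = c.incl := rfl

/-- **A cobordism to an empty manifold is a null-cobordism**: if `∂W = M ⊔ N` with `N` empty
then `∂W = M` (Milnor 1965, §1, Def. 1.3). Inverse to `toCobordism` on the data `(W, incl)`.
[cite: MilnorHCobordism1965, §1, Def. 1.3] -/
def ofCobordism [IsEmpty N] (c : Cobordism n M N) : NullCobordism n M where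
  W := c.W
  incl := c.inl
  isSmoothEmbedding_incl := c.isSmoothEmbedding_inl
  range_incl := by
    rw [← c.range_inl_union_range_inr, Set.range_eq_empty c.inr, Set.union_empty]

/-- The bounding manifold of the null-cobordism of a cobordism to `∅` is its total space.
[folklore] -/
@[simp] theorem ofCobordism_W [IsEmpty N] (c : Cobordism n M N) : (ofCobordism c).W = c.W := rfl

/-- The boundary inclusion of the null-cobordism of a cobordism to `∅` is its incoming end.
[folklore] -/
@[simp] theorem ofCobordism_incl [IsEmpty N] (c : Cobordism n M N) :
    (ofCobordism c).incl = c.inl := rfl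

/-- `ofCobordism ∘ toCobordism` is the identity on null-cobordisms. [folklore] -/
@[simp] theorem ofCobordism_toCobordism (c : NullCobordism n M) (N : Type u) [TopologicalSpace N]
    [ChartedSpace (𝔼 n) N] [IsEmpty N] : ofCobordism (c.toCobordism N) = c := by
  cases c
  rfl

variable (n) in
/-- **`𝕊ⁿ = ∂𝔻ⁿ⁺¹`**: the closed unit ball, with the manifold-with-boundary structure of
`ClosedBall.lean` (`Literature.Topology.FourManifolds.instChartedSpaceClosedBall`, `Literature.Topology.FourManifolds.instIsManifoldClosedBall`), is a
null-cobordism of the standard sphere `𝕊ⁿ` (Mathlib's analytic sphere): the inclusion is a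
smooth embedding (`Literature.Topology.FourManifolds.isSmoothEmbedding_sphereInclusion'_holds`) onto the boundary
(`Literature.Topology.FourManifolds.range_inclusion_eq_boundary`). Kervaire–Milnor 1963, §4, identity (1) `Sⁿ # Sⁿ = Sⁿ` /
proof of Lemma 4.2 (`Sⁿ = bDⁿ⁺¹`); Lee, *Introduction to Smooth Manifolds* (2013), Problem 1-11.
Non-vacuity witness for `NullCobordism`. [folklore] -/
def closedBall : NullCobordism n (𝕊 n) where
  W := 𝔻 (n + 1)
  incl := Set.inclusion Metric.sphere_subset_closedBall
  isSmoothEmbedding_incl := isSmoothEmbedding_sphereInclusion'_holds n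
  range_incl := range_inclusion_eq_boundary n

/-- The bounding manifold of `NullCobordism.closedBall n` is `𝔻ⁿ⁺¹` (definitional). [folklore] -/
@[simp] theorem closedBall_W : (closedBall n).W = 𝔻 (n + 1) := rfl

/-- The boundary inclusion of `NullCobordism.closedBall n` is `Set.inclusion` (definitional).
[folklore] -/
@[simp] theorem closedBall_incl :
    (closedBall n).incl = Set.inclusion Metric.sphere_subset_closedBall := rfl

end NullCobordism

section BoundsParallelizable

variable {n : ℕ} {M M' : Type u} [TopologicalSpace M] [ChartedSpace (𝔼 n) M]
  [TopologicalSpace M'] [ChartedSpace (𝔼 n) M']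

/-- `M` **bounds a parallelizable manifold**: there is a compact smooth `(n+1)`-manifold with
boundary `W` with `∂W = M` (`Literature.Topology.FourManifolds.NullCobordism`) whose tangent bundle is trivial
(`Literature.IsParallelizable (𝓡∂ (n + 1)) W`: a global continuous framing). Kervaire–Milnor, *Groups of
homotopy spheres I* (1963), §4, first paragraph: "A homotopy `n`-sphere `M` represents an element
of `bPₙ₊₁` if and only if `M` is the boundary of a parallelizable manifold"; Lemma 4.2 (`0 ∈ p(M)`
iff `M` bounds a parallelizable manifold). Orientations are ignored (see the module docstring:
for connected `M` this is equivalent to the oriented reading, since `∂(-W) = -∂W`).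
This is a *definition* — Kervaire–Milnor's condition on `M` cutting out `bPₙ₊₁`, a predicate in
`(n, M)` — not a theorem: it fails e.g. for every non-compact `M` (`∂W` is closed in the compact
`W`), and holds for `M = 𝕊ⁿ = ∂𝔻ⁿ⁺¹` (`Literature.Topology.FourManifolds.boundsParallelizable_sphere`,
`HomotopySpheresBPOrder.lean`, from `IsParallelizable.closedBall`). The binders `(n M)` are
written on the declaration (rather than supplied by `variable (n M) in`) so that the statement
reads as the two-parameter predicate it is; the elaborated signature is unchanged. [cite: KervaireMilnorAnnals1963, §4 (definition of bP_{n+1}, p. 510) and Lemma 4.2] -/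
def BoundsParallelizable (n : ℕ) (M : Type u) [TopologicalSpace M] [ChartedSpace (𝔼 n) M] :
    Prop :=
  ∃ c : NullCobordism.{u} n M, IsParallelizable (𝓡∂ (n + 1)) c.W

/-- Bounding a parallelizable manifold is invariant under diffeomorphism: transport the
null-cobordism along the diffeomorphism (`NullCobordism.comap`), keeping `W`
(Kervaire–Milnor 1963, §4 with §1). [cite: KervaireMilnorAnnals1963, §4, first paragraph] -/
theorem BoundsParallelizable.of_diffeomorph [IsManifold (𝓡 n) ∞ M] [IsManifold (𝓡 n) ∞ M']
    (h : BoundsParallelizable n M) (φ : M ≃ₘ⟮𝓡 n, 𝓡 n⟯ M') : BoundsParallelizable n M' := by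
  obtain ⟨c, hc⟩ := h
  exact ⟨c.comap φ.symm, hc⟩

/-- Diffeomorphic smooth manifolds simultaneously bound, or do not bound, parallelizable
manifolds (Kervaire–Milnor 1963, §4). [cite: KervaireMilnorAnnals1963, §4, first paragraph] -/
theorem boundsParallelizable_iff_of_diffeomorph [IsManifold (𝓡 n) ∞ M] [IsManifold (𝓡 n) ∞ M']
    (φ : M ≃ₘ⟮𝓡 n, 𝓡 n⟯ M') : BoundsParallelizable n M ↔ BoundsParallelizable n M' :=
  ⟨fun h => h.of_diffeomorph φ, fun h => h.of_diffeomorph φ.symm⟩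

end BoundsParallelizable

/-! ### `bPₙ₊₁ ⊆ Θₙ` -/

namespace HomotopySphere

variable {n : ℕ}

/-- A homotopy `n`-sphere **bounds a parallelizable manifold** if its underlying closed manifold
does (`Literature.Topology.FourManifolds.BoundsParallelizable`); these are the homotopy spheres representing the elements of
Kervaire–Milnor's `bPₙ₊₁` (*Groups of homotopy spheres I* (1963), §4, first paragraph). The
orientation plays no role (`boundsParallelizable_neg_iff`). [cite: KervaireMilnorAnnals1963, §4 (definition of bP_{n+1})] -/
def BoundsParallelizable (S : HomotopySphere n) : Prop :=
  Literature.Topology.FourManifolds.BoundsParallelizable n S.carrier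

/-- `-Σ` bounds a parallelizable manifold iff `Σ` does: the underlying manifold is the same
(Kervaire–Milnor 1963, §4: `bPₙ₊₁` is a subgroup, in particular closed under `Σ ↦ -Σ`; here by
definition, since orientations are not recorded in `Literature.Topology.FourManifolds.BoundsParallelizable`). [cite: KervaireMilnorAnnals1963, §4] -/
@[simp] theorem boundsParallelizable_neg_iff (S : HomotopySphere n) :
    S.neg.BoundsParallelizable ↔ S.BoundsParallelizable :=
  Iff.rfl

/-- Oriented-diffeomorphic homotopy spheres simultaneously bound parallelizable manifolds
(Kervaire–Milnor 1963, §4: "this condition depends only on the h-cobordism class of `M`",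
Lemma 4.3; for the diffeomorphism quotient used by `HomotopySphereClass` this is transport of
the null-cobordism, `Literature.Topology.FourManifolds.BoundsParallelizable.of_diffeomorph`). [cite: KervaireMilnorAnnals1963, §4, Lemma 4.3] -/
theorem BoundsParallelizable.of_isOrientedDiffeomorphic {S T : HomotopySphere n}
    (h : S.BoundsParallelizable) (hST : S.IsOrientedDiffeomorphic T) : T.BoundsParallelizable := by
  obtain ⟨φ, -⟩ := hST
  exact Literature.Topology.FourManifolds.BoundsParallelizable.of_diffeomorph h φ

/-- Oriented-diffeomorphic homotopy spheres simultaneously bound parallelizable manifolds,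
`iff` form (Kervaire–Milnor 1963, §4, Lemma 4.3). [cite: KervaireMilnorAnnals1963, §4, Lemma 4.3] -/
theorem boundsParallelizable_iff_of_isOrientedDiffeomorphic {S T : HomotopySphere n}
    (hST : S.IsOrientedDiffeomorphic T) : S.BoundsParallelizable ↔ T.BoundsParallelizable := by
  obtain ⟨φ, -⟩ := hST
  exact Literature.Topology.FourManifolds.boundsParallelizable_iff_of_diffeomorph φ

/-- **`Θ₇ = bP₈`** (named fact). Every homotopy `7`-sphere bounds a parallelizable (compact,
smooth, `8`-dimensional) manifold. Kervaire–Milnor, *Groups of homotopy spheres I* (1963), §4: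
by Lemma 4.2 and Lemma 4.5 the Pontryagin–Thom construction `Σ ↦ p(Σ)` induces an injective
homomorphism `Θₙ / bPₙ₊₁ ↪ Πₙ / p(Sⁿ)` into the cokernel of the stable `J`-homomorphism
`Jₙ : πₙ(SO) → Πₙ = π_{n+k}(Sᵏ)` (proof of Thm. 4.1 and Remarks, p. 512), and `Π₇ / p(S⁷) = 0`
(table p. 512: `Π₇ ≅ ℤ/240` is the image of `J₇`; Milnor–Kervaire 1958, Adams), so that
`bP₈ = Θ₇`. Kosinski, *Differential Manifolds* (1993), Ch. X §6, exact sequence (6.6)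
`0 → bPᵐ⁺¹ → θᵐ → Coker Jₘ` and "since `Coker J₇ = 0`, `θ⁷ = bP⁸`" (p. 218). Since bounding a
parallelizable manifold is a property of the h-cobordism (a fortiori oriented diffeomorphism)
class (Lemma 4.3), the statement for classes is the statement for every homotopy `7`-sphere.
Not proved here: the Pontryagin–Thom construction, framed cobordism, `Π₇ ≅ ℤ/240` and the
surjectivity of `J₇` are absent from Mathlib and from the tree. [cite: KervaireMilnorAnnals1963, §4: Lemmas 4.2, 4.3, 4.5, proof of Thm. 4.1 and table p. 512 (Π₇/p(S⁷) = 0)] [cite: Kosinski1993, Ch. X §6, (6.6) and p. 218 (Coker J₇ = 0, θ⁷ = bP⁸ = ℤ₂₈)] -/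
def boundsParallelizable_seven : Prop :=
  ∀ S : HomotopySphere 7, S.BoundsParallelizable

end HomotopySphere

namespace HomotopySphereClass

variable {n : ℕ}

variable (n) in
/-- **Kervaire–Milnor's `bPₙ₊₁ ⊆ Θₙ`**: the set of classes in `Θₙ = HomotopySphereClass n`
represented by a homotopy `n`-sphere which bounds a parallelizable manifold
(`HomotopySphere.BoundsParallelizable`). Kervaire–Milnor, *Groups of homotopy spheres I* (1963),
§4: "A homotopy `n`-sphere `M` represents an element of `bPₙ₊₁` if and only if `M` is the
boundary of a parallelizable manifold." Membership does not depend on the representative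
(`mk_mem_bP_iff`). It is a subgroup for the connected-sum group structure (Kervaire–Milnor, §4,
via Lemmas 4.2, 4.4, 4.5: the kernel of `p' : Θₙ → Πₙ / p(Sⁿ)`); here it is a `Set`, the tree
fixing no group structure on `Θₙ` (see `isCyclic_bP_four_mul`). Indexed by `n` (so that
`bP n ⊆ Θₙ` is Kervaire–Milnor's `bPₙ₊₁`). [cite: KervaireMilnorAnnals1963, §4 (definition of bP_{n+1})] -/
def bP : Set (HomotopySphereClass n) :=
  {a | ∃ S : HomotopySphere n, mk S = a ∧ S.BoundsParallelizable}

/-- The class of a homotopy sphere bounding a parallelizable manifold lies in `bPₙ₊₁`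
(Kervaire–Milnor 1963, §4). [cite: KervaireMilnorAnnals1963, §4] -/
theorem mk_mem_bP {S : HomotopySphere n} (h : S.BoundsParallelizable) : mk S ∈ bP n :=
  ⟨S, rfl, h⟩

/-- **`bPₙ₊₁` is well defined on `Θₙ`**: the class of `Σ` lies in `bPₙ₊₁` iff `Σ` itself bounds a
parallelizable manifold. Two homotopy spheres with the same class are related by a chain of
oriented diffeomorphisms (`Quot.exact` gives `EqvGen`; no appeal to the named fact
`HomotopySphereClass.mk_eq_mk_iff` is needed), and each step transports null-cobordisms in both
directions (`HomotopySphere.boundsParallelizable_iff_of_isOrientedDiffeomorphic`).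
Kervaire–Milnor 1963, §4 ("this condition depends only on the h-cobordism class of `M`",
Lemma 4.3). [cite: KervaireMilnorAnnals1963, §4, Lemma 4.3] -/
theorem mk_mem_bP_iff {S : HomotopySphere n} : mk S ∈ bP n ↔ S.BoundsParallelizable := by
  refine ⟨?_, mk_mem_bP⟩
  rintro ⟨T, hT, hTb⟩
  have hgen : Relation.EqvGen HomotopySphere.IsOrientedDiffeomorphic T S := Quot.eqvGen_exact hT
  have key : ∀ {A B : HomotopySphere n},
      Relation.EqvGen HomotopySphere.IsOrientedDiffeomorphic A B →
        (A.BoundsParallelizable ↔ B.BoundsParallelizable) := by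
    intro A B hAB
    induction hAB with
    | rel _ _ h => exact HomotopySphere.boundsParallelizable_iff_of_isOrientedDiffeomorphic h
    | refl _ => exact Iff.rfl
    | symm _ _ _ ih => exact ih.symm
    | trans _ _ _ _ _ ih₁ ih₂ => exact ih₁.trans ih₂
  exact (key hgen).mp hTb

/-- `bPₙ₊₁` is stable under orientation reversal `[Σ] ↦ [-Σ]` (the inverse in `Θₙ`,
`exists_commGroup_homotopySphereClass`): `-Σ = ∂(-W)` bounds the same parallelizable manifold
(Kervaire–Milnor 1963, §4: `bPₙ₊₁` is a subgroup). [cite: KervaireMilnorAnnals1963, §4] -/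
@[simp] theorem neg_mem_bP_iff (a : HomotopySphereClass n) : a.neg ∈ bP n ↔ a ∈ bP n := by
  induction a using HomotopySphereClass.ind with
  | h S => rw [neg_mk, mk_mem_bP_iff, mk_mem_bP_iff, HomotopySphere.boundsParallelizable_neg_iff]

/-- `Θ₇ = bP₈`, set form: under the named fact `HomotopySphere.boundsParallelizable_seven` every
class of `Θ₇` lies in `bP₈` (Kervaire–Milnor 1963, §4, table p. 512; Kosinski 1993, Ch. X §6,
p. 218). [cite: KervaireMilnorAnnals1963, §4, table p. 512] -/
theorem bP_seven_eq_univ (h : HomotopySphere.boundsParallelizable_seven) :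
    bP 7 = Set.univ := by
  refine Set.eq_univ_of_forall fun a => ?_
  induction a using HomotopySphereClass.ind with
  | h S => exact mk_mem_bP (h S)

/-- **`bP₄ₘ` is finite cyclic** (named fact; Kervaire–Milnor, *Groups of homotopy spheres I*
(1963), Cor. 7.6, p. 530: "The group `bP₄ₘ`, `m > 1`, is isomorphic to a subgroup of the cyclic
group of order `σₘ`. Hence `bP₄ₘ` is finite cyclic."). Stated on the tree's `Θₙ`, `n + 1 = 4m`
(no `ℕ`-subtraction), which fixes no group structure: for **every** commutative group structure on
`Θₙ = HomotopySphereClass n` whose multiplication is the connected sum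
(`HomotopySphereClass.IsMul a b c → a * b = c`; such structures exist by
`exists_commGroup_homotopySphereClass` and all have the same multiplication by
`HomotopySphereClass.isMul_exists`, Kervaire–Milnor Thm. 1.1), the subset `bPₙ₊₁ = bP n` is the
underlying set of a subgroup (§4, p. 512: "these elements form a group which we will denote by
`bPₙ₊₁ ⊂ Θₙ`", the kernel of `p' : Θₙ → Πₙ / p(Sⁿ)`) which is finite and cyclic. For `n = 4m - 1 ≥ 7` the tree's `Θₙ`
(oriented diffeomorphism classes) is Kervaire–Milnor's h-cobordism group by Smale's h-cobordism
theorem (Milnor 1965, Thm. 9.1; `HomotopySphere.isHCobordant_iff_nonempty_diffeomorph_of_five_le`),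
under which Thm. 7.5 ("`Σ₁` h-cobordant to `Σ₂` iff `σ(M₁) ≡ σ(M₂) mod σₘ`") becomes a statement
about equality of classes. Secondary source: Kosinski, *Differential Manifolds* (1993), Ch. X,
Prop. 6.2(a) (`bP⁴ⁿ` is finite cyclic of order `tₙ/8`, `n > 1`).
**Proof status in the tree.** The primary clause of Cor. 7.6 (the embedding into `ℤ/σₘ` by the
signature of a bounding s-parallelizable manifold) and every printed ingredient of its "evident"
proof are vendored downstream, in `HomotopySpheresSignature.lean` (which imports this file, hence
cannot be imported here): `σ(M)` and `σₘ` as `HomotopySphere.signatureSet` and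
`HomotopySphere.sigmaGen`, Lemma 7.4 (`HomotopySphere.exists_mem_signatureSet_sphere_ne_zero`),
Thm. 7.5 on classes (`HomotopySphere.mk_eq_mk_iff_sigmaGen_dvd_sub`), the additivity of `σ` over
connected sums along the boundary, §2 (`HomotopySphere.add_mem_signatureSet_of_isOrientedConnectedSum`),
and the two Lemma 3.4 comparisons between "bounds a parallelizable manifold" and "bounds an
oriented s-parallelizable one" (`HomotopySphere.nonempty_signatureSet_of_boundsParallelizable`;
`HomotopySphere.boundsParallelizable_of_mem_signatureSet`, proved as
`HomotopySphere.boundsParallelizable_of_mem_signatureSet_holds`). From exactly these five named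
facts this fact is **proved**: `HomotopySphereClass.isCyclic_bP_four_mul_of_signatureFacts`
(`HomotopySpheresBPCyclic.lean`; Kervaire–Milnor p. 530: `[Σ] ↦ σ(M) mod σₘ` is a well-defined
injective homomorphism `bPₙ₊₁ → ℤ/σₘ`, and `σₘ ≠ 0` by Lemma 7.4), pointwise in each dimension as
`HomotopySphereClass.exists_subgroup_coe_eq_bP_of_dim`, and without Lemma 7.4 for the cyclicity
clause alone (`HomotopySphereClass.isCyclic_of_coe_subset_bP`, `HomotopySpheresBPCyclicThm75.lean`).
The discharge `isCyclic_bP_four_mul_holds` is therefore that theorem applied to the `_holds` of the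
four remaining inputs — Lemma 7.4, Thm. 7.5 (itself reduced in
`HomotopySpheresSignatureReduction.lean` to Lemma 7.3, the h-cobordism theorem and
§2-additivity), §2-additivity and Lemma 3.4 "⇒" — and this fact is not decomposed any further
(D-0026): surgery (§§5–7, Lemma 7.3) and the almost-parallelizable manifolds of Lemma 7.4
(Milnor–Kervaire 1958) enter only through those inputs. The summit-side use, `Θ₇` cyclic
(`Literature.Topology.FourManifolds.exists_commGroup_homotopySphereClass_isCyclic_seven`), needs
only the instance `m = 2` and is also assembled directly from the dimension-`7` inputs
(`exists_commGroup_homotopySphereClass_isCyclic_seven_of_dim`, `HomotopySpheresBPCyclic.lean`). [cite: KervaireMilnorAnnals1963, Cor. 7.6 (p. 530), with Thm. 7.5, §4 p. 512 (bP_{n+1} is a subgroup) and Thm. 1.1] [cite: Kosinski1993, Ch. X §6, Prop. 6.2(a)] [cite: MilnorHCobordism1965, Thm. 9.1] -/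
def isCyclic_bP_four_mul : Prop :=
  ∀ (m n : ℕ), 1 < m → n + 1 = 4 * m →
    ∀ [CommGroup (HomotopySphereClass n)],
      (∀ a b c : HomotopySphereClass n, IsMul a b c → a * b = c) →
        ∃ H : Subgroup (HomotopySphereClass n),
          (H : Set (HomotopySphereClass n)) = bP n ∧ IsCyclic H ∧ Finite H

end HomotopySphereClass

/-! ### Layer 2 of `Θ₇ = bP₈`: Thm. 3.1 and the Pontryagin–Thom step, separated -/

namespace HomotopySphere

/-- **Homotopy spheres are s-parallelizable** (named fact; Kervaire–Milnor, *Groups of homotopy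
spheres I* (1963), Thm. 3.1, p. 508: "Every homotopy sphere is s-parallelizable."). Here
"s-parallelizable" is Kervaire–Milnor's definition (p. 508): the Whitney sum `τ ⊕ ε¹` of the
tangent bundle with a trivial line bundle is trivial, i.e. the tree's
`Literature.IsStablyParallelizable (𝓡 n) Σ` (`Spin.lean`: a global continuous framing of `TΣ ⊕ ℝ`), and a
homotopy `n`-sphere is a closed oriented smooth `n`-manifold homotopy equivalent to `𝕊ⁿ`
(`Literature.HomotopySphere n`; the orientation plays no role). No restriction on `n` is printed. The
printed proof is obstruction theory for the stable tangent bundle with coefficients in the stable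
groups `πᵢ₋₁(SO)` (Bott periodicity): for `n ≡ 3, 5, 6, 7 (mod 8)` — in particular `n = 7` — the
top obstruction group `πₙ₋₁(SO)` vanishes (Case 1); `n ≡ 0, 4 (mod 8)` uses the Hirzebruch
signature theorem (Case 2); `n ≡ 1, 2 (mod 8)` uses Rohlin's `J ∘ oₙ = 0` and the injectivity of
`Jₙ₋₁` (Adams) (Case 3). Not proved here. **Status.** The fact is kept as printed (all `n`) and
is a theory as a whole: beyond Case 1 the printed proof needs Pontryagin classes with the
Hirzebruch signature theorem (Case 2) and Rohlin's `Jₙ₋₁ ∘ oₙ = 0` with Adams' injectivity of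
`Jₙ₋₁` (Case 3), none of which is in Mathlib or in the tree, nor is Bott periodicity for general
`n`. Instances proved in the tree: `n ≤ 1` unconditionally, `n = 2`, `n = 3` and
`n ∈ {5, 6, 12, 56, 61}` from the smooth-Poincaré facts of those dimensions
(`HomotopySpheresStablyParallelizableStandard.lean`: `isStablyParallelizable_of_le_one`,
`isStablyParallelizable_two_of`, `isStablyParallelizable_three_of`,
`isStablyParallelizable_of_mem_of`), and `n = 7` — the only instance the `Θ₇` decomposition
uses — from Bott's `π₆(SO(8)) = 0` (`HomotopySphere.isStablyParallelizable_seven_of`,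
`HomotopySpheresStablyParallelizable.lean`: the clutching argument of Case 1 is the proved
theorem `isStablyParallelizable_of_hasStableTangentFramingAlong_compl_singleton`, over the named
facts `Bott1959_sphereMapsToStableFramesExtend_six` — equivalent to
`Subsingleton (π_ 6 SO(8) 1)` by `Bott1959_sphereMapsToStableFramesExtend_six_iff_specialOrthogonalGroup`,
`HomotopySpheresStablyParallelizableOrthogonal.lean` — and
`HomotopySphere.hasStableTangentFramingAlong_compl_singleton`, the latter reduced by
`HomotopySphere.hasStableTangentFramingAlong_compl_singleton_of_contractibleSpace_compl_singleton`
(`HomotopySpheresStablyParallelizableProofs.lean`: covering homotopy theorem for stable framings,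
proved) to the theorem `HomotopySphere.contractibleSpace_compl_singleton_holds`). Accordingly this
all-`n` fact is not a leaf of the `Θ₇` decomposition (`boundsParallelizable_seven_of` below is
superseded there by `HomotopySphere.boundsParallelizable_seven_of'`); it remains the hypothesis
"Thm. 3.1" of the `Θ₄ = 0` chain at `n = 4` (`HomotopySphere.boundsParallelizable_four_of`,
`isHCobordant_sphere_of_homotopySphere_four_of_leaves`, `ThetaFourKervaireMilnor.lean`;
`PiStableFourCollapse.lean`; `Literature/Barriers/SmoothPoincare4/`), where the printed proof is
Case 2 (`π₃(SO) = ℤ`). [cite: KervaireMilnorAnnals1963, Thm. 3.1 (p. 508), with the definition of s-parallelizable (p. 508)] -/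
def isStablyParallelizable : Prop :=
  ∀ (n : ℕ) (S : HomotopySphere n), IsStablyParallelizable (𝓡 n) S.carrier

/-- **An s-parallelizable homotopy `7`-sphere bounds a parallelizable manifold** (named fact):
the contribution of Kervaire–Milnor's §4 to `Θ₇ = bP₈`, with Thm. 3.1
(`HomotopySphere.isStablyParallelizable`) factored out. Kervaire–Milnor, *Groups of homotopy
spheres I* (1963), §4: for an s-parallelizable closed `Mⁿ ⊂ Sⁿ⁺ᵏ` (`k > n + 1`; normal bundle
trivial by Lemma 3.3) the Pontryagin–Thom construction applied to the normal framings `φ` gives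
a subset `p(M) = {p(M, φ)} ⊂ Πₙ = πₙ₊ₖ(Sᵏ)` (p. 510); Lemma 4.2: "The subset `p(M) ⊂ Πₙ`
contains the zero element of `Πₙ` if and only if `M` bounds a parallelizable manifold";
Lemma 4.5: for any homotopy sphere `Σ`, `p(Σ)` is a coset of the subgroup `p(Sⁿ) ⊂ Πₙ`, and
(Remarks, p. 512) `p(Sⁿ)` is the image of the Hopf–Whitehead homomorphism
`Jₙ : πₙ(SO_k) → πₙ₊ₖ(Sᵏ)`, with `Π₇ / p(S⁷) = 0` (table p. 512; `Π₇ ≅ ℤ/240 = im J₇`,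
Milnor–Kervaire 1958, Adams). Hence for `n = 7`, `p(Σ) = Π₇ ∋ 0` and `Σ` bounds a
parallelizable manifold. Kosinski, *Differential Manifolds* (1993), Ch. X §6, (6.6) and p. 218
("`Coker J₇ = 0`"). Together with Thm. 3.1 this is `HomotopySphere.boundsParallelizable_seven`
(`boundsParallelizable_seven_of`, proved). Not proved here: the Pontryagin–Thom construction,
framed cobordism, the `J`-homomorphism and the `2`-, `3`- and `5`-primary computations of `Π₇` are absent from
Mathlib and from the tree. [cite: KervaireMilnorAnnals1963, §4: p. 510 (p(M) ⊂ Πₙ), Lemma 4.2, Lemma 4.5, Remarks and table p. 512 (Π₇/p(S⁷) = 0)] [cite: Kosinski1993, Ch. X §6, (6.6) and p. 218 (Coker J₇ = 0)] -/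
def boundsParallelizable_of_isStablyParallelizable_seven : Prop :=
  ∀ S : HomotopySphere 7, IsStablyParallelizable (𝓡 7) S.carrier → S.BoundsParallelizable

/-- **`Θ₇ = bP₈` from its two printed ingredients**: if every homotopy sphere is
s-parallelizable (Kervaire–Milnor 1963, Thm. 3.1; `isStablyParallelizable`) and every
s-parallelizable homotopy `7`-sphere bounds a parallelizable manifold (§4 with
`Π₇ / p(S⁷) = 0`; `boundsParallelizable_of_isStablyParallelizable_seven`), then every homotopy
`7`-sphere bounds a parallelizable manifold (`boundsParallelizable_seven`). This is the order of
the argument on p. 510: "Given an s-parallelizable closed manifold `M` …". Superseded within the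
decomposition by `HomotopySphere.boundsParallelizable_seven_of'`
(`HomotopySpheresStablyParallelizable.lean`), which consumes Thm. 3.1 only at `n = 7`, through its
two leaves; kept as the glue used by `exists_commGroup_homotopySphereClass_isCyclic_seven_of'`
(`HCobordismProofs.lean`). [cite: KervaireMilnorAnnals1963, Thm. 3.1 and §4 (p. 510, table p. 512)] -/
theorem boundsParallelizable_seven_of (ha : isStablyParallelizable)
    (hb : boundsParallelizable_of_isStablyParallelizable_seven) : boundsParallelizable_seven :=
  fun S => hb S (ha 7 S)

end HomotopySphere

end Literature.Topology.FourManifolds
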